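import Summits.QuantumFields.YangMills.Theorems.UnitScaleTiltProp7HcoSOfSymDiffDivRows
import Summits.QuantumFields.YangMills.Theorems.UnitScaleTiltProp7DivSliceRowHolds
import HarnessLib

/-!
# Route `UnitScaleTilt`, crux K1 «MinimiserStabilityRegPr» (stmt-QuantumFields-19200) — ARCHITECTURE (A′) ON Σ: **THE (DV) ROW IS A THEOREM — `hcoS` ⇐ (N06) ∧ (S) ∧ (β)**
# (the crude divergence slice discharged by ★px19 g5 ✓p698515 `div_sq_le_of_isLandauPrint_of_regPr` through ★px12 g6 ✓`hV_of_hcompKnit`)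

Cell `ym3-torus` ∕ fleet seat `ym-ust-19200-p1` (gen 18, route-R E′ growth-side lead ∕ namer).  THEOREMS ONLY (0 `def`, 0 `sorry`); `--supports stmt-QuantumFields-19200`, count-neutral.
YM₃ on T³ is a ladder rung (R3), not the Clay problem; nothing here claims the stub, the crux, `hcoS`, d = 4 or the mass gap — (N06), (S), (β) stay DISPLAYED hypotheses.

WHY.  Of the three P-A2 rows of ✓`Prop7PA2OfSymDiffDivRows.hPA2_of_symL1_diffL1_divSlice` the divergence slice (DV) is now closed: ★px19 g5's P-A4 knit ✓p698515 gives, at every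
`W ∈ RegPr F n K a` inside three L-only windows and for every `X` with `IsLandauPrint F n K W X`, `‖D*_W X̃‖² ≤ 36⁶∕16·(3 + 27a²)·‖X̃‖²` ([Balaban1985RegularSpaces] (1.38) slice, crude form),
and ★px12 g6's ✓`hV_of_hcompKnit` ∕ ✓`Prop7DivSliceRowHolds.hV_holds` turn exactly that ∀-shape into the (DV) row text (`ζ := 0`, `δ₁ := 2·36⁶∕16·(3 + 27eV²)`, ✓p697059 DV-SEAM) with NO
hypothesis left.  This file records the consequence for the junction: `hcoS` ⇐ (N06) ∧ (S) ∧ (β) (the (DV) slot of the assembler door fed by `hV_holds` by name).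

WHAT IS PROVED (ns `…Theorems.Prop7HcoSOfSymDiffRows`): ★★★ `hPA2_of_symL1_diffL1` — `hPA2` ⇐ (S) ∧ (β); ★★★ `hcoS_of_normG0_of_symL1_diffL1` — `hcoS` ⇐ (N06) ∧ (S) ∧ (β).
HONEST SCOPE.  Two `exact`s over landed theorems (★px12 g6's `hV_holds` by name); (N06) XL, (β) L∕XL (`hMcomb`), (S) hours remain displayed; nothing of print asserted; rung R3, not Clay; YM gap NOT proved.

References: T. Bałaban, CMP 102 (1985) 277–309 [Balaban1985Variational] ((44)–(47) pp.285–286, (106)–(111) p.294, (141)–(142) p.299); CMP 99 (1985) 75–102 [Balaban1985RegularSpaces]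
((1.9) p.77, (1.38) p.82); CMP 99 (1985) 389–434 [Balaban1985BackgroundPropagators] (Thm 3.11 p.416).
-/

set_option autoImplicit false
noncomputable section

open scoped BigOperators Matrix.Norms.L2Operator Matrix Topology InnerProductSpace
open Filter NormedSpace

namespace Summit.QuantumFields.YangMills.Theorems.Prop7HcoSOfSymDiffRows

open Literature.MathematicalPhysics.QuantumFieldTheory.Balaban1983to89
open Literature.MathematicalPhysics.QuantumFieldTheory.Balaban1983to89.T3ContinuumYM3Torus
open Literature.MathematicalPhysics.QuantumFieldTheory.Balaban1983to89.T3UnitLawDensityEML (ℰp)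
open Literature.MathematicalPhysics.QuantumFieldTheory.Balaban1983to89.T3ConstrainedMinimiser (fibre)
open Literature.MathematicalPhysics.QuantumFieldTheory.Balaban1983to89.T3PrintedRegularMinimiser
open Literature.MathematicalPhysics.QuantumFieldTheory.Balaban1983to89.T3RegularMinimiser
open Literature.MathematicalPhysics.QuantumFieldTheory.Balaban1983to89.T3Thm1Carrier
open T4Continuum BlockAveraging AveragingRT ExpMeanLog BlockAveragingEMLLinearised BlockAveragingEMLLinearisedBackground BlockAveragingEMLProp2
open B10Eq27TorusAxialLog (pull unitsField toUField)
open B9Eq39Adjoint (divB)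
open B9TorusCalculus (torusT)
open T3SectALandauChart (emb15 eta eta_pos bgUnits In19)
open B11Eq103H1Complex (BondL2K laplaceAK)
open Summit.QuantumFields.YangMills.Theorems.Prop7SPrint (basePt RestrictedPrint AvgCondPrint IsLandauPrint)
open Summit.QuantumFields.YangMills.Theorems.Prop7TPrint (expHermField)
open Summit.QuantumFields.YangMills.Theorems.Prop7SectET3Transport (periodsT3)
open Summit.QuantumFields.YangMills.Theorems.Prop7SectET3HilbertLetters (W₂ toL2 toL2B DL2 DstarL2)
open Summit.QuantumFields.YangMills.Theorems.Prop7SectET3WilsonHessian (DeltaEta DeltaEtaSlot)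
open Summit.QuantumFields.YangMills.Theorems.Prop7SectET3CombLetters (Qkc)
open Summit.QuantumFields.YangMills.Theorems.Prop7QprimeCombL2 (RcombL2)
open Summit.QuantumFields.YangMills.Theorems.Prop7SymAvgTw (QTw CmapTw)
open Summit.QuantumFields.YangMills.Theorems.Prop7SymAvgTwSym (CmapTwS)
open Summit.QuantumFields.YangMills.Theorems.Prop7PA2OfSymDiffDivRows (hPA2_of_symL1_diffL1_divSlice)
open Summit.QuantumFields.YangMills.Theorems.Prop7HcoSOfSymDiffDivRows (hcoS_of_normG0_of_symL1_diffL1_divSlice)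
open Summit.QuantumFields.YangMills.Theorems.Prop7DivSliceRowHolds (hV_holds)

/-! ## `hPA2` and `hcoS` with the (DV) row discharged (★px12 g6 ✓`Prop7DivSliceRowHolds.hV_holds`) -/

/-- ★★★ **THE P-A2 BINDER FROM (S) AND (β) ALONE** — ✓`hPA2_of_symL1_diffL1_divSlice` with `hV := hV_holds`. [cite: Balaban1985Variational, (44)-(47) pp.285-286, (106)-(111) p.294] -/
theorem hPA2_of_symL1_diffL1
    (hS : ∀ (L : ℕ), 1 < L → ∀ (B₁' : ℝ), 0 < B₁' → ∃ eS CS₁ CS₂ : ℝ, 0 < eS ∧ 0 ≤ CS₁ ∧ 0 ≤ CS₂ ∧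
      ∀ (F : T3Family), F.L = L → ∀ (n K : ℕ) (hnK : n < K) (e : ℝ) (V : GaugeField (F.P n) 0 (Matrix.specialUnitaryGroup (Fin 2) ℂ))
        (W : GaugeField (F.P K) 0 (Matrix.specialUnitaryGroup (Fin 2) ℂ)) (X : PBond (F.P K) 0 → Matrix (Fin 2) (Fin 2) ℂ),
        0 < e → e ≤ eS → W ∈ regFibrePr F n K hnK.le e V →
        (∀ γ : ℝ → GaugeField (F.P K) 0 (Matrix.specialUnitaryGroup (Fin 2) ℂ), γ 0 = W → (∀ t, γ t ∈ fibre F ℰp n K hnK.le V) →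
          (∀ b, DifferentiableAt ℝ (fun t => ((γ t b : Matrix.specialUnitaryGroup (Fin 2) ℂ) : Matrix (Fin 2) (Fin 2) ℂ)) 0) →
            deriv (fun t => wilsonAction4 (γ t)) 0 = 0) →
        In19 F n K (2 * B₁' * e) W (expHermField X) X → AvgCondPrint F n K hnK.le V W X → IsLandauPrint F n K W X →
          ∑ ĉ : PBond (F.P n) 0, ‖CmapTwS F n K hnK.le W (fun b => Complex.I • X b) ĉ‖
              ≤ CS₁ * ((F.L : ℝ) ^ (K - n))⁻¹ * (∑ b : PBond (F.P K) 0, ‖X b‖ ^ 2) + CS₂ * ((F.L : ℝ) ^ (K - n)) * ((∑ p : Plaq (F.P K) 0, ‖((Complex.I • X ⟨p.src, p.μ⟩) + ((W ⟨p.src, p.μ⟩ : Matrix (Fin 2) (Fin 2) ℂ) * (Complex.I • X ⟨p.src.shift p.μ, p.ν⟩) * star (W ⟨p.src, p.μ⟩ : Matrix (Fin 2) (Fin 2) ℂ))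
            - (((W ⟨p.src, p.μ⟩ * W ⟨p.src.shift p.μ, p.ν⟩ * (W ⟨p.src.shift p.ν, p.μ⟩)⁻¹ : Matrix.specialUnitaryGroup (Fin 2) ℂ) : Matrix (Fin 2) (Fin 2) ℂ) * (Complex.I • X ⟨p.src.shift p.ν, p.μ⟩) * star ((W ⟨p.src, p.μ⟩ * W ⟨p.src.shift p.μ, p.ν⟩ * (W ⟨p.src.shift p.ν, p.μ⟩)⁻¹ : Matrix.specialUnitaryGroup (Fin 2) ℂ) : Matrix (Fin 2) (Fin 2) ℂ))
            - (((GaugeField.plaqHol W p : Matrix.specialUnitaryGroup (Fin 2) ℂ) : Matrix (Fin 2) (Fin 2) ℂ) * (Complex.I • X ⟨p.src, p.ν⟩) * star ((GaugeField.plaqHol W p : Matrix.specialUnitaryGroup (Fin 2) ℂ) : Matrix (Fin 2) (Fin 2) ℂ)))‖ ^ 2) + (∑ x : Site (F.P K) 0, ∑ j : Fin 2, ∑ k : Fin 2,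
              ‖(divB (torusT (F.P K) 0) (fun κ z => unitsField (toUField W) ⟨z, κ⟩) (fun κ z => Complex.I • X ⟨z, κ⟩) x) j k‖ ^ 2)))
    (hD : ∀ (L : ℕ), 1 < L → ∀ (B₁' : ℝ), 0 < B₁' → ∃ eD CD₁ CD₂ : ℝ, 0 < eD ∧ 0 ≤ CD₁ ∧ 0 ≤ CD₂ ∧
      ∀ (F : T3Family), F.L = L → ∀ (n K : ℕ) (hnK : n < K) (e : ℝ) (V : GaugeField (F.P n) 0 (Matrix.specialUnitaryGroup (Fin 2) ℂ))
        (W : GaugeField (F.P K) 0 (Matrix.specialUnitaryGroup (Fin 2) ℂ)) (X : PBond (F.P K) 0 → Matrix (Fin 2) (Fin 2) ℂ),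
        0 < e → e ≤ eD → W ∈ regFibrePr F n K hnK.le e V →
        (∀ γ : ℝ → GaugeField (F.P K) 0 (Matrix.specialUnitaryGroup (Fin 2) ℂ), γ 0 = W → (∀ t, γ t ∈ fibre F ℰp n K hnK.le V) →
          (∀ b, DifferentiableAt ℝ (fun t => ((γ t b : Matrix.specialUnitaryGroup (Fin 2) ℂ) : Matrix (Fin 2) (Fin 2) ℂ)) 0) →
            deriv (fun t => wilsonAction4 (γ t)) 0 = 0) →
        In19 F n K (2 * B₁' * e) W (expHermField X) X → AvgCondPrint F n K hnK.le V W X → IsLandauPrint F n K W X →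
          ∑ ĉ : PBond (F.P n) 0, ‖CmapTw F n K hnK.le W (fun b => Complex.I • X b) ĉ - CmapTwS F n K hnK.le W (fun b => Complex.I • X b) ĉ‖
              ≤ CD₁ * ((F.L : ℝ) ^ (K - n))⁻¹ * (∑ b : PBond (F.P K) 0, ‖X b‖ ^ 2) + CD₂ * ((F.L : ℝ) ^ (K - n)) * ((∑ p : Plaq (F.P K) 0, ‖((Complex.I • X ⟨p.src, p.μ⟩) + ((W ⟨p.src, p.μ⟩ : Matrix (Fin 2) (Fin 2) ℂ) * (Complex.I • X ⟨p.src.shift p.μ, p.ν⟩) * star (W ⟨p.src, p.μ⟩ : Matrix (Fin 2) (Fin 2) ℂ))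
            - (((W ⟨p.src, p.μ⟩ * W ⟨p.src.shift p.μ, p.ν⟩ * (W ⟨p.src.shift p.ν, p.μ⟩)⁻¹ : Matrix.specialUnitaryGroup (Fin 2) ℂ) : Matrix (Fin 2) (Fin 2) ℂ) * (Complex.I • X ⟨p.src.shift p.ν, p.μ⟩) * star ((W ⟨p.src, p.μ⟩ * W ⟨p.src.shift p.μ, p.ν⟩ * (W ⟨p.src.shift p.ν, p.μ⟩)⁻¹ : Matrix.specialUnitaryGroup (Fin 2) ℂ) : Matrix (Fin 2) (Fin 2) ℂ))
            - (((GaugeField.plaqHol W p : Matrix.specialUnitaryGroup (Fin 2) ℂ) : Matrix (Fin 2) (Fin 2) ℂ) * (Complex.I • X ⟨p.src, p.ν⟩) * star ((GaugeField.plaqHol W p : Matrix.specialUnitaryGroup (Fin 2) ℂ) : Matrix (Fin 2) (Fin 2) ℂ)))‖ ^ 2) + (∑ x : Site (F.P K) 0, ∑ j : Fin 2, ∑ k : Fin 2,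
              ‖(divB (torusT (F.P K) 0) (fun κ z => unitsField (toUField W) ⟨z, κ⟩) (fun κ z => Complex.I • X ⟨z, κ⟩) x) j k‖ ^ 2))) :
    ∀ (L : ℕ), 1 < L → ∀ (B₁' : ℝ), 0 < B₁' → ∃ eJ C₁ C₂ ζ δ₁ : ℝ, 0 < eJ ∧ 0 ≤ C₁ ∧ 0 ≤ C₂ ∧ 0 ≤ ζ ∧ 0 ≤ δ₁ ∧
      ∀ (F : T3Family), F.L = L → ∀ (n K : ℕ) (hnK : n < K) (e : ℝ) (V : GaugeField (F.P n) 0 (Matrix.specialUnitaryGroup (Fin 2) ℂ))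
        (W : GaugeField (F.P K) 0 (Matrix.specialUnitaryGroup (Fin 2) ℂ)) (X : PBond (F.P K) 0 → Matrix (Fin 2) (Fin 2) ℂ),
        0 < e → e ≤ eJ → W ∈ regFibrePr F n K hnK.le e V →
        (∀ γ : ℝ → GaugeField (F.P K) 0 (Matrix.specialUnitaryGroup (Fin 2) ℂ), γ 0 = W → (∀ t, γ t ∈ fibre F ℰp n K hnK.le V) →
          (∀ b, DifferentiableAt ℝ (fun t => ((γ t b : Matrix.specialUnitaryGroup (Fin 2) ℂ) : Matrix (Fin 2) (Fin 2) ℂ)) 0) →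
            deriv (fun t => wilsonAction4 (γ t)) 0 = 0) →
        In19 F n K (2 * B₁' * e) W (expHermField X) X → AvgCondPrint F n K hnK.le V W X → IsLandauPrint F n K W X →
          ∃ dv : ℝ, ∑ ĉ : PBond (F.P n) 0, ‖CmapTw F n K hnK.le W (fun b => Complex.I • X b) ĉ‖
              ≤ C₁ * ((F.L : ℝ) ^ (K - n))⁻¹ * (∑ b : PBond (F.P K) 0, ‖X b‖ ^ 2) + C₂ * ((F.L : ℝ) ^ (K - n)) * ((∑ p : Plaq (F.P K) 0, ‖((Complex.I • X ⟨p.src, p.μ⟩) + ((W ⟨p.src, p.μ⟩ : Matrix (Fin 2) (Fin 2) ℂ) * (Complex.I • X ⟨p.src.shift p.μ, p.ν⟩) * star (W ⟨p.src, p.μ⟩ : Matrix (Fin 2) (Fin 2) ℂ))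
            - (((W ⟨p.src, p.μ⟩ * W ⟨p.src.shift p.μ, p.ν⟩ * (W ⟨p.src.shift p.ν, p.μ⟩)⁻¹ : Matrix.specialUnitaryGroup (Fin 2) ℂ) : Matrix (Fin 2) (Fin 2) ℂ) * (Complex.I • X ⟨p.src.shift p.ν, p.μ⟩) * star ((W ⟨p.src, p.μ⟩ * W ⟨p.src.shift p.μ, p.ν⟩ * (W ⟨p.src.shift p.ν, p.μ⟩)⁻¹ : Matrix.specialUnitaryGroup (Fin 2) ℂ) : Matrix (Fin 2) (Fin 2) ℂ))
            - (((GaugeField.plaqHol W p : Matrix.specialUnitaryGroup (Fin 2) ℂ) : Matrix (Fin 2) (Fin 2) ℂ) * (Complex.I • X ⟨p.src, p.ν⟩) * star ((GaugeField.plaqHol W p : Matrix.specialUnitaryGroup (Fin 2) ℂ) : Matrix (Fin 2) (Fin 2) ℂ)))‖ ^ 2) + dv) ∧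
            dv ≤ ζ * (∑ p : Plaq (F.P K) 0, ‖((Complex.I • X ⟨p.src, p.μ⟩) + ((W ⟨p.src, p.μ⟩ : Matrix (Fin 2) (Fin 2) ℂ) * (Complex.I • X ⟨p.src.shift p.μ, p.ν⟩) * star (W ⟨p.src, p.μ⟩ : Matrix (Fin 2) (Fin 2) ℂ))
            - (((W ⟨p.src, p.μ⟩ * W ⟨p.src.shift p.μ, p.ν⟩ * (W ⟨p.src.shift p.ν, p.μ⟩)⁻¹ : Matrix.specialUnitaryGroup (Fin 2) ℂ) : Matrix (Fin 2) (Fin 2) ℂ) * (Complex.I • X ⟨p.src.shift p.ν, p.μ⟩) * star ((W ⟨p.src, p.μ⟩ * W ⟨p.src.shift p.μ, p.ν⟩ * (W ⟨p.src.shift p.ν, p.μ⟩)⁻¹ : Matrix.specialUnitaryGroup (Fin 2) ℂ) : Matrix (Fin 2) (Fin 2) ℂ))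
            - (((GaugeField.plaqHol W p : Matrix.specialUnitaryGroup (Fin 2) ℂ) : Matrix (Fin 2) (Fin 2) ℂ) * (Complex.I • X ⟨p.src, p.ν⟩) * star ((GaugeField.plaqHol W p : Matrix.specialUnitaryGroup (Fin 2) ℂ) : Matrix (Fin 2) (Fin 2) ℂ)))‖ ^ 2) + δ₁ * (((F.L : ℝ) ^ (K - n)) ^ 2)⁻¹ * (∑ b : PBond (F.P K) 0, ‖X b‖ ^ 2) :=
  hPA2_of_symL1_diffL1_divSlice hS hD hV_holds

section E2E

variable (c₀ cB a₀ : ℕ → ℝ) [hc₀ : ∀ L : ℕ, Fact (0 < c₀ L)] [hcB : ∀ L : ℕ, Fact (0 < cB L)]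

/-- ★★★ **THE GROWTH SOCKET `hcoS` FROM (N06) ∧ (S) ∧ (β)** — ✓`hcoS_of_normG0_of_symL1_diffL1_divSlice` with `hV := hV_holds`.  CONCLUSION: `hcoS` VERBATIM.
[cite: Balaban1985Variational, (141)-(142) p.299, (44)-(47) pp.285-286; Balaban1985BackgroundPropagators, Thm 3.11 p.416; Balaban1985RegularSpaces, (1.38) p.82] -/
theorem hcoS_of_normG0_of_symL1_diffL1 (ha₀ : ∀ L : ℕ, 0 ≤ a₀ L)
    (hN06 : ∀ (L : ℕ), 1 < L → ∃ B₀ eN : ℝ, 0 < B₀ ∧ 0 < eN ∧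
      ∀ (F : T3Family), F.L = L → ∀ (n K : ℕ) (hnK : n < K) (e : ℝ) (W : GaugeField (F.P K) 0 (Matrix.specialUnitaryGroup (Fin 2) ℂ)),
        0 < e → e ≤ eN → RegPr F n K e W →
        ∃ G₀ : BondL2K ℂ 3 (periodsT3 F K) (c₀ F.L) W₂ →ₗ[ℂ] BondL2K ℂ 3 (periodsT3 F K) (c₀ F.L) W₂,
          laplaceAK (DeltaEtaSlot F n K (c₀ F.L) W) (DL2 F n K (c₀ F.L) W) (RcombL2 F n K (c₀ F.L) W) (DstarL2 F n K (c₀ F.L) W)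
              (Qkc F n K hnK.le (c₀ F.L) (cB F.L) W) (LinearMap.adjoint (Qkc F n K hnK.le (c₀ F.L) (cB F.L) W))
              (((a₀ F.L * (c₀ F.L / cB F.L) * ((F.L : ℝ) ^ (K - n)) ^ 3 : ℝ) : ℂ)) ∘ₗ G₀ = LinearMap.id ∧
          ∀ f, ‖G₀ f‖ ≤ B₀ * ‖f‖)
    (hS : ∀ (L : ℕ), 1 < L → ∀ (B₁' : ℝ), 0 < B₁' → ∃ eS CS₁ CS₂ : ℝ, 0 < eS ∧ 0 ≤ CS₁ ∧ 0 ≤ CS₂ ∧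
      ∀ (F : T3Family), F.L = L → ∀ (n K : ℕ) (hnK : n < K) (e : ℝ) (V : GaugeField (F.P n) 0 (Matrix.specialUnitaryGroup (Fin 2) ℂ))
        (W : GaugeField (F.P K) 0 (Matrix.specialUnitaryGroup (Fin 2) ℂ)) (X : PBond (F.P K) 0 → Matrix (Fin 2) (Fin 2) ℂ),
        0 < e → e ≤ eS → W ∈ regFibrePr F n K hnK.le e V →
        (∀ γ : ℝ → GaugeField (F.P K) 0 (Matrix.specialUnitaryGroup (Fin 2) ℂ), γ 0 = W → (∀ t, γ t ∈ fibre F ℰp n K hnK.le V) →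
          (∀ b, DifferentiableAt ℝ (fun t => ((γ t b : Matrix.specialUnitaryGroup (Fin 2) ℂ) : Matrix (Fin 2) (Fin 2) ℂ)) 0) →
            deriv (fun t => wilsonAction4 (γ t)) 0 = 0) →
        In19 F n K (2 * B₁' * e) W (expHermField X) X → AvgCondPrint F n K hnK.le V W X → IsLandauPrint F n K W X →
          ∑ ĉ : PBond (F.P n) 0, ‖CmapTwS F n K hnK.le W (fun b => Complex.I • X b) ĉ‖
              ≤ CS₁ * ((F.L : ℝ) ^ (K - n))⁻¹ * (∑ b : PBond (F.P K) 0, ‖X b‖ ^ 2) + CS₂ * ((F.L : ℝ) ^ (K - n)) * ((∑ p : Plaq (F.P K) 0, ‖((Complex.I • X ⟨p.src, p.μ⟩) + ((W ⟨p.src, p.μ⟩ : Matrix (Fin 2) (Fin 2) ℂ) * (Complex.I • X ⟨p.src.shift p.μ, p.ν⟩) * star (W ⟨p.src, p.μ⟩ : Matrix (Fin 2) (Fin 2) ℂ))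
            - (((W ⟨p.src, p.μ⟩ * W ⟨p.src.shift p.μ, p.ν⟩ * (W ⟨p.src.shift p.ν, p.μ⟩)⁻¹ : Matrix.specialUnitaryGroup (Fin 2) ℂ) : Matrix (Fin 2) (Fin 2) ℂ) * (Complex.I • X ⟨p.src.shift p.ν, p.μ⟩) * star ((W ⟨p.src, p.μ⟩ * W ⟨p.src.shift p.μ, p.ν⟩ * (W ⟨p.src.shift p.ν, p.μ⟩)⁻¹ : Matrix.specialUnitaryGroup (Fin 2) ℂ) : Matrix (Fin 2) (Fin 2) ℂ))
            - (((GaugeField.plaqHol W p : Matrix.specialUnitaryGroup (Fin 2) ℂ) : Matrix (Fin 2) (Fin 2) ℂ) * (Complex.I • X ⟨p.src, p.ν⟩) * star ((GaugeField.plaqHol W p : Matrix.specialUnitaryGroup (Fin 2) ℂ) : Matrix (Fin 2) (Fin 2) ℂ)))‖ ^ 2) + (∑ x : Site (F.P K) 0, ∑ j : Fin 2, ∑ k : Fin 2,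
              ‖(divB (torusT (F.P K) 0) (fun κ z => unitsField (toUField W) ⟨z, κ⟩) (fun κ z => Complex.I • X ⟨z, κ⟩) x) j k‖ ^ 2)))
    (hD : ∀ (L : ℕ), 1 < L → ∀ (B₁' : ℝ), 0 < B₁' → ∃ eD CD₁ CD₂ : ℝ, 0 < eD ∧ 0 ≤ CD₁ ∧ 0 ≤ CD₂ ∧
      ∀ (F : T3Family), F.L = L → ∀ (n K : ℕ) (hnK : n < K) (e : ℝ) (V : GaugeField (F.P n) 0 (Matrix.specialUnitaryGroup (Fin 2) ℂ))
        (W : GaugeField (F.P K) 0 (Matrix.specialUnitaryGroup (Fin 2) ℂ)) (X : PBond (F.P K) 0 → Matrix (Fin 2) (Fin 2) ℂ),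
        0 < e → e ≤ eD → W ∈ regFibrePr F n K hnK.le e V →
        (∀ γ : ℝ → GaugeField (F.P K) 0 (Matrix.specialUnitaryGroup (Fin 2) ℂ), γ 0 = W → (∀ t, γ t ∈ fibre F ℰp n K hnK.le V) →
          (∀ b, DifferentiableAt ℝ (fun t => ((γ t b : Matrix.specialUnitaryGroup (Fin 2) ℂ) : Matrix (Fin 2) (Fin 2) ℂ)) 0) →
            deriv (fun t => wilsonAction4 (γ t)) 0 = 0) →
        In19 F n K (2 * B₁' * e) W (expHermField X) X → AvgCondPrint F n K hnK.le V W X → IsLandauPrint F n K W X →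
          ∑ ĉ : PBond (F.P n) 0, ‖CmapTw F n K hnK.le W (fun b => Complex.I • X b) ĉ - CmapTwS F n K hnK.le W (fun b => Complex.I • X b) ĉ‖
              ≤ CD₁ * ((F.L : ℝ) ^ (K - n))⁻¹ * (∑ b : PBond (F.P K) 0, ‖X b‖ ^ 2) + CD₂ * ((F.L : ℝ) ^ (K - n)) * ((∑ p : Plaq (F.P K) 0, ‖((Complex.I • X ⟨p.src, p.μ⟩) + ((W ⟨p.src, p.μ⟩ : Matrix (Fin 2) (Fin 2) ℂ) * (Complex.I • X ⟨p.src.shift p.μ, p.ν⟩) * star (W ⟨p.src, p.μ⟩ : Matrix (Fin 2) (Fin 2) ℂ))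
            - (((W ⟨p.src, p.μ⟩ * W ⟨p.src.shift p.μ, p.ν⟩ * (W ⟨p.src.shift p.ν, p.μ⟩)⁻¹ : Matrix.specialUnitaryGroup (Fin 2) ℂ) : Matrix (Fin 2) (Fin 2) ℂ) * (Complex.I • X ⟨p.src.shift p.ν, p.μ⟩) * star ((W ⟨p.src, p.μ⟩ * W ⟨p.src.shift p.μ, p.ν⟩ * (W ⟨p.src.shift p.ν, p.μ⟩)⁻¹ : Matrix.specialUnitaryGroup (Fin 2) ℂ) : Matrix (Fin 2) (Fin 2) ℂ))
            - (((GaugeField.plaqHol W p : Matrix.specialUnitaryGroup (Fin 2) ℂ) : Matrix (Fin 2) (Fin 2) ℂ) * (Complex.I • X ⟨p.src, p.ν⟩) * star ((GaugeField.plaqHol W p : Matrix.specialUnitaryGroup (Fin 2) ℂ) : Matrix (Fin 2) (Fin 2) ℂ)))‖ ^ 2) + (∑ x : Site (F.P K) 0, ∑ j : Fin 2, ∑ k : Fin 2,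
              ‖(divB (torusT (F.P K) 0) (fun κ z => unitsField (toUField W) ⟨z, κ⟩) (fun κ z => Complex.I • X ⟨z, κ⟩) x) j k‖ ^ 2))) :
    ∀ (L : ℕ), 1 < L → ∀ (B₁' : ℝ), 0 < B₁' → ∃ e₇ : ℝ, 0 < e₇ ∧
      ∀ (F : T3Family), F.L = L → ∀ (n K : ℕ) (hnK : n < K) (e : ℝ) (V : GaugeField (F.P n) 0 (Matrix.specialUnitaryGroup (Fin 2) ℂ))
        (W : GaugeField (F.P K) 0 (Matrix.specialUnitaryGroup (Fin 2) ℂ)) (X : PBond (F.P K) 0 → Matrix (Fin 2) (Fin 2) ℂ),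
        0 < e → e ≤ e₇ → W ∈ regFibrePr F n K hnK.le e V →
        (∀ γ : ℝ → GaugeField (F.P K) 0 (Matrix.specialUnitaryGroup (Fin 2) ℂ), γ 0 = W → (∀ t, γ t ∈ fibre F ℰp n K hnK.le V) →
          (∀ b, DifferentiableAt ℝ (fun t => ((γ t b : Matrix.specialUnitaryGroup (Fin 2) ℂ) : Matrix (Fin 2) (Fin 2) ℂ)) 0) →
            deriv (fun t => wilsonAction4 (γ t)) 0 = 0) →
        In19 F n K (2 * B₁' * e) W (expHermField X) X → AvgCondPrint F n K hnK.le V W X → IsLandauPrint F n K W X →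
          wilsonAction4 W ≤ wilsonAction4 (emb15 W (expHermField X)) := by
  exact hcoS_of_normG0_of_symL1_diffL1_divSlice c₀ cB a₀ ha₀ hN06 hS hD hV_holds

end E2E

end Summit.QuantumFields.YangMills.Theorems.Prop7HcoSOfSymDiffRows

end
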